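import Summits.CriticalPhenomena.Ising3DConformalLimit.Theorems.PrecisionLaplacianDirectCorrelationStableTailPickInversionAux11
import Summits.CriticalPhenomena.Ising3DConformalLimit.Theorems.PrecisionLaplacianDirectCorrelationStableTailPickInversionAux12
import Summits.CriticalPhenomena.Ising3DConformalLimit.Theorems.PrecisionLaplacianDirectCorrelationStableTailSlabSpectralRepresentation

/-!
# Pick inversion, auxiliary file 16: slab quadratic forms of the Green function as integrals of
# the slab transforms; evenness of the slab transforms

Helper file for stub `stub_pickInversion` of line `self-energy-pick-inversion`, crux
`PrecisionLaplacian.DirectCorrelationStableTail` (stmt-CriticalPhenomena-4799). Pure theorem file.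

For the Green function `G = ∑_j P j` of an even sub-stochastic step law `q` on `ℤ³` with symbol `φ`,
a direction `i`, the slab transforms `h_n(k) = ∫_{-π}^{π} cos(nθ) (1 - φ(ins_i(θ, k)))⁻¹ dθ` and a
finitely supported real `v` on `ℤ²`:
* `slab_form_eq_integral` (registered sub-goal `stub_pickInversion_auxSlabForm`):
  `(2π)³ ∑_{x,y∈s} v x v y G(ins_i(n, x - y)) = ∫_{[-π,π]²} h_n(k) W_v(k) dk` and `h_n` is integrable
  on `[-π,π]²` (file 11 with `S = ins_i(0, s)`, `u = n eᵢ`, then Fubini along the `i`-th coordinate,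
  file 12);
* `slab_transform_neg` : `h_n(-k) = h_n(k)` (the symbol is even).
-/

noncomputable section

namespace Summit.CriticalPhenomena.Ising3DConformalLimit.Cruxes.DirectCorrelationStableTail.SelfEnergyPickInversion

open Filter Topology Finset Real MeasureTheory Literature.Probability.LatticeModels
open scoped BigOperators
open Summit.CriticalPhenomena.Ising3DConformalLimit.Theorems.EtaBoundsTransfer
  (continuous_phase continuous_fourier_q abs_fourier_q_le_one integrableOn_cube_of_continuous
    volume_cube_lt_top)

variable {q : Site 3 → ℝ} {P : ℕ → Site 3 → ℝ}

/-- `y ↦ ins_i(0, y)` is injective. [folklore] -/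
theorem insertNth_zero_injective (i : Fin 3) :
    Function.Injective fun y : Fin 2 → ℤ => (Fin.insertNth i (0 : ℤ) y : Site 3) := by
  intro y y' h
  have := congrArg (fun z : Site 3 => fun j => z (i.succAbove j)) h
  simpa [Fin.insertNth_apply_succAbove] using this

/-- **Slab quadratic forms as integrals of the slab transforms.** [folklore] -/
theorem slab_form_eq_integral (hq0 : ∀ y, 0 ≤ q y) (hqs : Summable q) (hq1 : ∑' y, q y ≤ 1)
    (hqev : ∀ y, q (-y) = q y) (hP0 : ∀ z, P 0 z = if z = 0 then 1 else 0)
    (hPs : ∀ j z, P (j + 1) z = ∑' y, q y * P j (z - y))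
    {G : Site 3 → ℝ} (hGreen : ∀ z, HasSum (fun j => P j z) (G z))
    (i : Fin 3) (s : Finset (Fin 2 → ℤ)) (v : (Fin 2 → ℤ) → ℝ) (n : ℕ) :
    IntegrableOn (fun k : Fin 2 → ℝ => ∫ θ in (-π)..π, Real.cos (n * θ) *
        (1 - ∑' x : Site 3, q x * Real.cos (phase 3 (Fin.insertNth i θ k : Fin 3 → ℝ) x))⁻¹)
      (Set.pi Set.univ (fun _ : Fin 2 => Set.Icc (-π) π)) volume ∧
    (2 * π) ^ 3 * ∑ x ∈ s, ∑ y ∈ s, v x * v y * G (Fin.insertNth i (n : ℤ) (x - y) : Site 3) =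
      ∫ k in Set.pi Set.univ (fun _ : Fin 2 => Set.Icc (-π) π),
        (∫ θ in (-π)..π, Real.cos (n * θ) *
          (1 - ∑' x : Site 3, q x * Real.cos (phase 3 (Fin.insertNth i θ k : Fin 3 → ℝ) x))⁻¹) *
        (∑ x ∈ s, ∑ y ∈ s, v x * v y * Real.cos (phase 2 k (x - y))) := by
  have hπ := Real.pi_pos
  set φ : (Fin 3 → ℝ) → ℝ := fun ξ => ∑' x : Site 3, q x * Real.cos (phase 3 ξ x) with hφ
  have hφcont : Continuous φ := continuous_fourier_q hqs
  obtain ⟨hint, hae⟩ := integrableOn_inv_one_sub_symbol hq0 hqs hq1 hqev hP0 hPs (hGreen 0)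
  set K3 := Set.pi Set.univ (fun _ : Fin 3 => Set.Icc (-π) π) with hK3
  set K2 := Set.pi Set.univ (fun _ : Fin 2 => Set.Icc (-π) π) with hK2
  -- the embedded set and weights
  set ins0 : (Fin 2 → ℤ) → Site 3 := fun y => Fin.insertNth i (0 : ℤ) y with hins0
  have hinj : Function.Injective ins0 := insertNth_zero_injective i
  set S : Finset (Site 3) := s.image ins0 with hS
  set V : Site 3 → ℝ := fun z => v (fun j => z (i.succAbove j)) with hV
  have hVins : ∀ y, V (ins0 y) = v y := fun y => by simp [hV, hins0, Fin.insertNth_apply_succAbove]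
  set u : Site 3 := Pi.single i (n : ℤ) with hu
  -- the Green form over `S` is the slab form over `s`
  have hsum : ∑ z ∈ S, ∑ z' ∈ S, V z * V z' * G (z - z' + u) =
      ∑ x ∈ s, ∑ y ∈ s, v x * v y * G (Fin.insertNth i (n : ℤ) (x - y) : Site 3) := by
    rw [hS, Finset.sum_image (hinj.injOn)]
    refine Finset.sum_congr rfl fun x _ => ?_
    rw [Finset.sum_image (hinj.injOn)]
    refine Finset.sum_congr rfl fun y _ => ?_
    rw [hVins, hVins, hins0, hu, insertNth_zero_sub_add_single i n y x]
  -- the weight restricted to slabs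
  have hW : ∀ θ (k : Fin 2 → ℝ), ∑ z ∈ S, ∑ z' ∈ S, V z * V z' * Real.cos (phase 3 (Fin.insertNth i θ k : Fin 3 → ℝ) (z - z')) =
      ∑ x ∈ s, ∑ y ∈ s, v x * v y * Real.cos (phase 2 k (x - y)) := by
    intro θ k
    rw [hS, Finset.sum_image (hinj.injOn)]
    refine Finset.sum_congr rfl fun x _ => ?_
    rw [Finset.sum_image (hinj.injOn)]
    refine Finset.sum_congr rfl fun y _ => ?_
    rw [hVins, hVins]
    have : ins0 x - ins0 y = (Fin.insertNth i (0 : ℤ) (x - y) : Site 3) := by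
      simp only [hins0]; rw [← Fin.insertNth_sub]; simp
    rw [this, phase_insertNth_insertNth]; simp
  -- file 11
  have hGF := green_form_eq_integral hq0 hqs hq1 hqev hP0 hPs hGreen S V u
  rw [hsum] at hGF
  -- Fubini along the `i`-th coordinate
  set W2 : (Fin 2 → ℝ) → ℝ := fun k => ∑ x ∈ s, ∑ y ∈ s, v x * v y * Real.cos (phase 2 k (x - y)) with hW2
  have hW2cont : Continuous W2 := by
    simp only [hW2]
    refine continuous_finsetSum _ fun x _ => continuous_finsetSum _ fun y _ => ?_
    have := continuous_phase (d := 2) (x - y); fun_prop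
  obtain ⟨B, hB⟩ : ∃ B, ∀ k, |W2 k| ≤ B := ⟨∑ x ∈ s, ∑ y ∈ s, |v x| * |v y|, fun k => by
    simp only [hW2]
    calc |∑ x ∈ s, ∑ y ∈ s, v x * v y * Real.cos (phase 2 k (x - y))|
        ≤ ∑ x ∈ s, |∑ y ∈ s, v x * v y * Real.cos (phase 2 k (x - y))| := Finset.abs_sum_le_sum_abs _ _
      _ ≤ ∑ x ∈ s, ∑ y ∈ s, |v x * v y * Real.cos (phase 2 k (x - y))| :=
          Finset.sum_le_sum fun x _ => Finset.abs_sum_le_sum_abs _ _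
      _ ≤ ∑ x ∈ s, ∑ y ∈ s, |v x| * |v y| :=
          Finset.sum_le_sum fun x _ => Finset.sum_le_sum fun y _ => by
            rw [abs_mul, abs_mul]
            exact mul_le_of_le_one_right (by positivity) (Real.abs_cos_le_one _)⟩
  set F : (Fin 3 → ℝ) → ℝ := fun ξ => Real.cos (phase 3 ξ u) * (1 - φ ξ)⁻¹ *
    (∑ z ∈ S, ∑ z' ∈ S, V z * V z' * Real.cos (phase 3 ξ (z - z'))) with hF
  set F0 : (Fin 3 → ℝ) → ℝ := fun ξ => Real.cos (n * ξ i) * (1 - φ ξ)⁻¹ with hF0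
  have hWScont : Continuous fun ξ : Fin 3 → ℝ => ∑ z ∈ S, ∑ z' ∈ S, V z * V z' * Real.cos (phase 3 ξ (z - z')) := by
    refine continuous_finsetSum _ fun x _ => continuous_finsetSum _ fun y _ => ?_
    have := continuous_phase (d := 3) (x - y); fun_prop
  have hWSins : ∀ θ k, (∑ z ∈ S, ∑ z' ∈ S, V z * V z' * Real.cos (phase 3 (Fin.insertNth i θ k : Fin 3 → ℝ) (z - z'))) = W2 k :=
    fun θ k => hW θ k
  have hFint : IntegrableOn F K3 volume := by
    have h1 : IntegrableOn (fun ξ => (1 - φ ξ)⁻¹ * (∑ z ∈ S, ∑ z' ∈ S, V z * V z' * Real.cos (phase 3 ξ (z - z')))) K3 volume := by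
      refine hint.mul_bdd (c := B) hWScont.aestronglyMeasurable (ae_of_all _ fun ξ => ?_)
      -- bound via the slab identity at `θ = ξ i`, `k = ξ_⊥`
      have := hB (fun j => ξ (i.succAbove j))
      rw [← hWSins (ξ i) (fun j => ξ (i.succAbove j))] at this
      have hξ : (Fin.insertNth i (ξ i) (fun j => ξ (i.succAbove j)) : Fin 3 → ℝ) = ξ :=
        Fin.insertNth_self_removeNth i ξ
      rw [hξ] at this
      rw [Real.norm_eq_abs]; exact this
    have hcos : Continuous fun ξ : Fin 3 → ℝ => Real.cos (phase 3 ξ u) :=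
      Real.continuous_cos.comp (continuous_phase u)
    have h2 : IntegrableOn F K3 volume := by
      refine (h1.bdd_mul (c := 1) hcos.aestronglyMeasurable
        (ae_of_all _ fun ξ => by rw [Real.norm_eq_abs]; exact Real.abs_cos_le_one _)).congr ?_
      exact ae_of_all _ fun ξ => by simp only [hF]; ring
    exact h2
  have hF0int : IntegrableOn F0 K3 volume := by
    have hcos : Continuous fun ξ : Fin 3 → ℝ => Real.cos (n * ξ i) := by fun_prop
    refine (hint.bdd_mul (c := 1) hcos.aestronglyMeasurable
      (ae_of_all _ fun ξ => by rw [Real.norm_eq_abs]; exact Real.abs_cos_le_one _)).congr ?_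
    exact ae_of_all _ fun ξ => by simp only [hF0, hφ]
  obtain ⟨-, hslab⟩ := setIntegral_cube_eq_slab i hFint
  obtain ⟨hint0, -⟩ := setIntegral_cube_eq_slab i hF0int
  -- the slices
  have hphase_u : ∀ θ (k : Fin 2 → ℝ), phase 3 (Fin.insertNth i θ k : Fin 3 → ℝ) u = n * θ := by
    intro θ k
    rw [hu, phase, Fin.sum_univ_succAbove _ i]
    simp [Fin.insertNth_apply_same, Fin.insertNth_apply_succAbove, Fin.succAbove_ne]
    ring_nf
  have hslice : ∀ k : Fin 2 → ℝ, ∫ θ in Set.Icc (-π) π, F (Fin.insertNth i θ k) =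
      (∫ θ in (-π)..π, Real.cos (n * θ) * (1 - φ (Fin.insertNth i θ k))⁻¹) * W2 k := by
    intro k
    rw [integral_Icc_eq_integral_Ioc, ← intervalIntegral.integral_of_le (by linarith), ← intervalIntegral.integral_mul_const]
    refine intervalIntegral.integral_congr fun θ _ => ?_
    simp only [hF, hphase_u, hWSins]
  have hslice0 : ∀ k : Fin 2 → ℝ, ∫ θ in Set.Icc (-π) π, F0 (Fin.insertNth i θ k) =
      ∫ θ in (-π)..π, Real.cos (n * θ) * (1 - φ (Fin.insertNth i θ k))⁻¹ := by
    intro k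
    rw [integral_Icc_eq_integral_Ioc, ← intervalIntegral.integral_of_le (by linarith)]
    refine intervalIntegral.integral_congr fun θ _ => ?_
    simp only [hF0, Fin.insertNth_apply_same]
  constructor
  · simp_rw [hslice0] at hint0
    exact hint0
  · rw [hGF]
    have : ∫ ξ in K3, Real.cos (phase 3 ξ u) * (1 - φ ξ)⁻¹ *
        (∑ z ∈ S, ∑ z' ∈ S, V z * V z' * Real.cos (phase 3 ξ (z - z'))) = ∫ ξ in K3, F ξ := rfl
    rw [this, hslab]
    exact integral_congr_ae (ae_of_all _ fun k => hslice k)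

/-- **Evenness of the slab transforms**: `h_n(-k) = h_n(k)` (the symbol is even). [folklore] -/
theorem slab_transform_neg (q : Site 3 → ℝ) (i : Fin 3) (n : ℕ) (k : Fin 2 → ℝ) :
    ∫ θ in (-π)..π, Real.cos (n * θ) *
        (1 - ∑' x : Site 3, q x * Real.cos (phase 3 (Fin.insertNth i θ (-k) : Fin 3 → ℝ) x))⁻¹ =
      ∫ θ in (-π)..π, Real.cos (n * θ) *
        (1 - ∑' x : Site 3, q x * Real.cos (phase 3 (Fin.insertNth i θ k : Fin 3 → ℝ) x))⁻¹ := by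
  have hsymm : ∀ θ, ∑' x : Site 3, q x * Real.cos (phase 3 (Fin.insertNth i θ (-k) : Fin 3 → ℝ) x) =
      ∑' x : Site 3, q x * Real.cos (phase 3 (Fin.insertNth i (-θ) k : Fin 3 → ℝ) x) := by
    intro θ
    refine tsum_congr fun x => ?_
    rw [phase_insertNth, phase_insertNth, ← Real.cos_neg]
    congr 1
    simp only [phase, Pi.neg_apply, neg_mul, Finset.sum_neg_distrib]
    ring
  simp_rw [hsymm]
  have h := intervalIntegral.integral_comp_neg (a := -π) (b := π)
    (fun θ => Real.cos (n * θ) * (1 - ∑' x : Site 3, q x * Real.cos (phase 3 (Fin.insertNth i θ k : Fin 3 → ℝ) x))⁻¹)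
  simp only [neg_neg] at h
  rw [← h]
  refine intervalIntegral.integral_congr fun θ _ => ?_
  simp only [mul_neg, Real.cos_neg]

/-- **Registered auxiliary stub `stub_pickInversion_auxSlabForm`** (sub-goal of `stub_pickInversion`):
slab quadratic forms of the Green function as integrals of the slab transforms (`slab_form_eq_integral`).
[folklore] -/
theorem stub_pickInversion_auxSlabForm : ∀ (q : Site 3 → ℝ) (P : ℕ → Site 3 → ℝ) (G : Site 3 → ℝ),
    (∀ y, 0 ≤ q y) → Summable q → ∑' y, q y ≤ 1 → (∀ y, q (-y) = q y) →
    (∀ z, P 0 z = if z = 0 then 1 else 0) → (∀ j z, P (j + 1) z = ∑' y, q y * P j (z - y)) →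
    (∀ z, HasSum (fun j => P j z) (G z)) →
    ∀ (i : Fin 3) (s : Finset (Fin 2 → ℤ)) (v : (Fin 2 → ℤ) → ℝ) (n : ℕ),
      (2 * Real.pi) ^ 3 * ∑ x ∈ s, ∑ y ∈ s, v x * v y * G (Fin.insertNth i (n : ℤ) (x - y) : Site 3) =
        ∫ k in Set.pi Set.univ (fun _ : Fin 2 => Set.Icc (-Real.pi) Real.pi),
          (∫ θ in (-Real.pi)..Real.pi, Real.cos (n * θ) *
            (1 - ∑' x : Site 3, q x * Real.cos (∑ j, (Fin.insertNth i θ k : Fin 3 → ℝ) j * (x j : ℝ)))⁻¹) *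
          (∑ x ∈ s, ∑ y ∈ s, v x * v y * Real.cos (∑ j, k j * ((x - y) j : ℝ))) :=
  fun _ _ _ hq0 hqs hq1 hqev hP0 hPs hGreen i s v n => by
    have h := (slab_form_eq_integral hq0 hqs hq1 hqev hP0 hPs hGreen i s v n).2
    simpa only [phase] using h

end Summit.CriticalPhenomena.Ising3DConformalLimit.Cruxes.DirectCorrelationStableTail.SelfEnergyPickInversion

end
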